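import Summits.QuantumFields.YangMills.Theorems.UnitScaleTiltProp8FlatPortCor28PadL0
import Literature.MathematicalPhysics.QuantumFieldTheory.Balaban1983to89.B6Cor28EntriesKLevelV1L3
import Literature.MathematicalPhysics.QuantumFieldTheory.Balaban1983to89.B6PadLevelV1L3
import HarnessLib

/-!
# Route `UnitScaleTilt`, crux K1 child «MinimiserStabilityRegPr» (stmt-QuantumFields-19200), v8 pillar **P2 `stub_flatOpsCubeSeq`** — THE PORT BRIDGE, file 4,
# **EVERY ODD `L ≥ 3`**: [Balaban1984PropagatorsII] COROLLARY 2.8 (2.151)₁,₂ AT k LEVELS FOR EVERY TORUS FAMILY, `k ≥ 1`, WITHOUT THE PLACEMENT HYPOTHESIS AND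
# **WITHOUT THE BLOCK-SIZE FLOOR `4 ≤ ℓ`** — the twin of ✓`UnitScaleTiltProp8FlatPortCor28PadL0.cor28_kLevel_H_DH_pad` obtained by reading lit-balaban's
# RE-CENTRED-WINDOW lineage `…V1L3` (sub-row G-F3′-L0∕L3, landed 2026-08-27∕28: `B6Cor28EntriesKLevelV1L3.cor28_kLevel_H_DH`, binder `4 ≤ ℓ` DROPPED,
# placement predicate `PlacedC` of the canonical central chart `B6CubeWindowV1L3`; `B6PadLevelV1L3.placed_pad`) instead of the level-0 lineage `…V1L0`

Cell `ym3-torus` (HUMAN RULING D-0037, YM ladder rung R3), seat `ym-inputs-p09` (cell `pub/ym-inputs`, on-call hand; ★★OWNER RULING g26-№20 L-FLOOR LEDGER, item LF-1 ∕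
(P2-L3)).  `--supports stmt-QuantumFields-19200 --as helper`; count-neutral; def-free.

WHY.  The H-side port of [Balaban1985BackgroundPropagators]'s Sect. F halving (pillar P2) reads Cor. 2.8 through three «pads» (`…Cor28PadL0`, `…Prop27PadL0`,
`B6Prop26LapKLevelV1L0.prop26_2136_lap_kLevel_unconditional_pad_V1`) that carry the block-size floor `4 ≤ ℓ` (`L = ℓ + 1 ≥ 5`) of the level-0 Literature port —
the located sub-gap (P2-L3) of the cell's debt list.  lit-balaban's L3 lineage removed that floor on the Literature side for every odd `L ≥ 3` (window corner
`x0C = ctr − (2L−1)S_j/2`, reach sub-window, `C = 9` unchanged); THIS FILE is the first Summits-side consumer: the same pad, over the L3 export.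

WHAT IS PROVED (sorry-free; axioms standard; no definition):
* §1 **`cor28_kLevel_H_DH_pad_allL`** = ✓`FlatPortCor28PadL0.cor28_kLevel_H_DH_pad` with the binder `(_ : 4 ≤ ℓ)` DELETED and nothing else changed: binder list
  `(1 ≤ k, k + 1 ≤ m + K, P′ = L·P″, P″ ≥ 5, M_h = Lᵃ ≥ 8, R ≥ 2L², M₂ ≤ L·M_h, N₁ + 1 ≤ R·L·M_h, band)`, SAME constants `σ₁, δ₅, C, M₂, N₁` (now those of the
  L3 export) and the same two conclusions `|(He_c)(f)| ≤ C·e^{−δ₅·d_T(y(f), β c)}`, `|(∇_νHe_c)(f)| ≤ C·(L^{j(y(f))}η)⁻¹·e^{−δ₅·d_T(y(f), β c)}` for the genuine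
  `H = GQ*(QGQ*)⁻¹` of `domT hN D hk`.  Proof = the L0 proof verbatim: pad by one empty level (`B6PadLevelV1L3.placed_pad` gives `PlacedC` below the top for
  every odd `L`), apply `B6Cor28EntriesKLevelV1L3.cor28_kLevel_H_DH`, transport back along `B6PadLevelV1L0.sameOm_domT_pad` with the window-free helpers of
  `…Cor28Pad`∕`…Cor28PadL0`∕`B6PadLevelV1L0` consumed BY NAME (`UI_single`, `H_UI`, `onFun_H_single`, `beta_pad`, `len_eT`, `eT_blkV1`, `dist_eT`,
  `globalBand_pad`).
HONEST SCOPE: bookkeeping over landed certificates (lit-balaban r03∕p21∕p33∕p34's L3 chain, p38's padding); inherits their standing hypotheses `M_h = Lᵃ ≥ 8`,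
`R ≥ 2L²`, the (2.16) band, `M₂ ≤ L·M_h`, `N₁ + 1 ≤ R·L·M_h`; the Hölder entry of (2.151) is not touched; nothing here proves `stub_halvingStep` or the crux;
YM₃ on T³ = rung R3, NOT the Clay problem, no bearing on d = 4 or a mass gap.

References: T. Bałaban, CMP **96** (1984) 223–250 [Balaban1984PropagatorsII] (2.1)–(2.4) p.224, (2.35) p.228, (2.46) p.231, Cor. 2.8 (2.150)–(2.151) p.249.
-/

set_option autoImplicit false

noncomputable section

open scoped BigOperators InnerProductSpace

namespace Summit.QuantumFields.YangMills.Theorems.FlatPortCor28PadAllL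

open FlatPortCor28Pad (UI_single H_UI onFun_H_single)
open FlatPortCor28PadL0 (beta_pad len_eT)

open Literature.MathematicalPhysics.QuantumFieldTheory.Balaban1983to89
open B6MultiLevelBoxOperator (N0)
open B6MultiLevelTorusOperatorL0 (TDomains)
open B6Geom246MultiLevelTorusL0 (geomT)
open B6GlobalChartV1 (PV)
open B6GlobalChartV1L0 (blkV1 domT)
open B6Ineq2142KLevelV1L0 (β)
open B6Ineq2133TwoScaleV1 (onFun)
open B6GradLegKLevelV1 (DV)
open B6SectAOperatorsV1 (BondIdx QsE)
open B6SectAVectorModelV1 (GE EE)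
open B6CubeWindowV1 (GlobalBand)
open B6PadLevelV1 (hN_pad)
open B6PadLevelV1L0 (padT sameOm_domT_pad eT_blkV1 dist_eT globalBand_pad)
open B6PadLevelV1L3 (placed_pad)
open B6Cor28EntriesKLevelV1L3 (cor28_kLevel_H_DH)

/-! ## §1 Corollary 2.8 (2.151)₁,₂ at k levels without the placement hypothesis, `k ≥ 1`, every odd `L ≥ 3` -/

section Main

variable {d ℓ : ℕ}

/-- **[B6] COROLLARY 2.8 (2.151)₁,₂ AT k LEVELS FOR THE GENUINE `H = GQ*(QGQ*)⁻¹`, EVERY ODD `L ≥ 3`, `k ≥ 1`, NO PLACEMENT HYPOTHESIS, NO BLOCK-SIZE FLOOR** —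
the binders of `B6Cor28EntriesKLevelV1L3.cor28_kLevel_H_DH` with `(2 ≤ k, P′ ≥ 5, all cubes placed (PlacedC))` replaced by `(1 ≤ k, k + 1 ≤ m + K, P′ = L·P″, P″ ≥ 5)`
(pad by one empty level, `B6PadLevelV1L3.placed_pad`; transport along `sameOm_domT_pad`); = ✓`FlatPortCor28PadL0.cor28_kLevel_H_DH_pad` with the binder `(4 ≤ ℓ)`
deleted: there are `σ₁ > 0` and, for every `σ ∈ (0, σ₁]`, `α ∈ (0, 1)`, constants `δ₅ > 0`, `C ≥ 0`, `M₂ > 0`, `N₁` such that for every such torus family, weights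
in the band, index bond `c`, fine bond `f`, direction `ν`: `|(He_c)(f)| ≤ C·e^{−δ₅·d_T(y(f), β c)}` and `|(∇_νHe_c)(f)| ≤ C·(L^{j(y(f))}η)⁻¹·e^{−δ₅·d_T(y(f), β c)}`.
[cite: Balaban1984PropagatorsII, Cor. 2.8 (2.150)–(2.151) p.249, (2.1)–(2.4) p.224] -/
theorem cor28_kLevel_H_DH_pad_allL (d ℓ : ℕ) (hd : 1 ≤ d + 1) (hL : Odd (ℓ + 1) ∧ 1 < ℓ + 1) {b₀ b₁ : ℝ} (hb₀ : 0 < b₀) (hb₁ : b₀ ≤ b₁) :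
    ∃ σ₁ : ℝ, 0 < σ₁ ∧ ∀ (σ : ℝ), 0 < σ → σ ≤ σ₁ → ∀ (α : ℝ), 0 < α → α < 1 →
    ∃ (δ₅ C M₂ : ℝ) (N₁ : ℕ), 0 < δ₅ ∧ 0 ≤ C ∧ 0 < M₂ ∧
    ∀ (m K : ℕ) {Mh k R : ℕ} {P' : Fin (d + 1) → ℕ}
      (hN : ∀ μ, N0 ℓ Mh k P' μ = (PV d ℓ m K hd hL).sitesPerDir 0) (D : TDomains d ℓ Mh k P' R) (hk : k ≤ m + K) (_ : 1 ≤ k) (_ : k + 1 ≤ m + K)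
      {P'' : Fin (d + 1) → ℕ} (_ : ∀ μ, P' μ = (ℓ + 1) * P'' μ) (_ : ∀ μ, 5 ≤ P'' μ)
      {a : ℕ} (_ : Mh = (ℓ + 1) ^ a) (_ : 8 ≤ Mh) (_ : 2 * (ℓ + 1) ^ 2 ≤ R)
      (_ : M₂ ≤ ((ℓ : ℝ) + 1) * Mh) (_ : N₁ + 1 ≤ R * ((ℓ + 1) * Mh))
      {cf : ℝ} (hcf : cf ≠ 0) {w : BondIdx (B6GlobalChartV1L0.domT hN D hk) → ℝ} (hw : ∀ i, 0 < w i) (_ : GlobalBand b₀ b₁ cf w),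
      (∀ (c : BondIdx (domT hN D hk)) (f : PBond (PV d ℓ m K hd hL) 0),
        |(GE (domT hN D hk) hcf hw ∘ₗ QsE (domT hN D hk) ∘ₗ EE (domT hN D hk) hcf hw) (EuclideanSpace.single c (1 : ℝ)) f| ≤
          C * Real.exp (-(δ₅ * (geomT D).dist (blkV1 hN D f) (β hN D hk c)))) ∧
      (∀ (ν : Fin (d + 1)) (c : BondIdx (domT hN D hk)) (f : PBond (PV d ℓ m K hd hL) 0),
        |(DV ν cf ∘ₗ onFun (GE (domT hN D hk) hcf hw ∘ₗ QsE (domT hN D hk) ∘ₗ EE (domT hN D hk) hcf hw)) (Pi.single c 1) f| ≤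
          C * ((geomT D).len (blkV1 hN D f) * |cf|⁻¹)⁻¹ * Real.exp (-(δ₅ * (geomT D).dist (blkV1 hN D f) (β hN D hk c)))) := by
  obtain ⟨σ₁, hσ₁, h⟩ := cor28_kLevel_H_DH d ℓ hd hL hb₀ hb₁
  refine ⟨σ₁, hσ₁, fun σ hσ hσ1 α hα hα1 => ?_⟩
  obtain ⟨δ₅, C, M₂, N₁, hδ₅, hC, hM₂, hH⟩ := h σ hσ hσ1 α hα hα1
  refine ⟨δ₅, C, M₂, N₁, hδ₅, hC, hM₂, ?_⟩
  intro m K Mh k R P' hN D hk _hk1 hk' P'' hLP hP5 a hMha hM8 hR2 hM hRM cf hcf w hw hwb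
  -- the padded family and the transport data
  have hS := sameOm_domT_pad hN D hk hLP hk'
  have hw' : ∀ i, 0 < (w ∘ hS.idxB) i := fun i => hw _
  obtain ⟨key1, key2⟩ := hH m K (hN_pad hN hLP) (padT D hLP) hk' (by omega) hMha hM8 hR2 hP5 (placed_pad D hLP hP5) hM hRM hcf hw'
    (globalBand_pad D hLP hN hk hk' hwb)
  constructor
  · intro c f
    have h1 := key1 (hS.idxB.symm c) f
    rw [UI_single hS c, H_UI hS hcf hw hw', ← eT_blkV1 D hLP hN, beta_pad hN D hk hLP hk' c, dist_eT] at h1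
    exact h1
  · intro ν c f
    have h2 := key2 ν (hS.idxB.symm c) f
    rw [LinearMap.comp_apply, onFun_H_single hS hcf hw hw' c, ← eT_blkV1 D hLP hN, beta_pad hN D hk hLP hk' c, dist_eT, len_eT D hLP] at h2
    rw [LinearMap.comp_apply]
    exact h2

end Main

end Summit.QuantumFields.YangMills.Theorems.FlatPortCor28PadAllL

end
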